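import Mathlib.Analysis.Real.Sqrt
import Mathlib.Data.Nat.Choose.Basic
import Mathlib.Data.Nat.Cast.Order.Field
import Mathlib.Algebra.BigOperators.Intervals
import Mathlib.Tactic
import Literature.Barriers.CriticalPhenomena.RigorousRGSmallParameterHHWThm22Cert
import Literature.Barriers.CriticalPhenomena.RigorousRGSmallParameterHHWTaylorRecursion
import Literature.Barriers.CriticalPhenomena.RigorousRGSmallParameterHHWGibbs
import HarnessLib

/-!
# Hara–Hattori–Watanabe 2001, Theorem 2.2: certificate soundness, part 1 (arithmetic of the primitives)

First of four theorem-only files proving that the integer certificate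
`Literature.Barriers.CriticalPhenomena.HierarchicalRG.Thm22Cert.Cfg.check`
(`RigorousRGSmallParameterHHWThm22Cert.lean`, evaluated there: `cert_ok`) MEANS Proposition 5.1
of Hara–Hattori–Watanabe (CMP 220 (2001) 13–40, §5.2) for real coefficient sequences. The real
objects are the tree's: `HierarchicalRG.beta (Real.sqrt 2)` (`β = 1/c - 1/2`, (1.1), `c = √2`),
`HierarchicalRG.tildeCoef m n` (the weight `(2m+2n)!n!/(m!(m+n)!(2n)!)` of (5.6)) and
`HierarchicalRG.bOf` ((5.4)) of `RigorousRGSmallParameterHHWTaylorRecursion.lean`.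

Here: the real meaning of the fixed-point primitives and constant tables of the checker
(`O = 2^P`): ceiling division, `nsum = Finset.sum`, `binom = Nat.choose`, table reads, the
product form `tildeCoef m n = wnum n m / m!`, the validated square root
(`s2L ≤ √2·O ≤ s2L + 1`), `betL ≤ βO ≤ betH`, `βcO ≤ rH`, the product `mulH`, the power tables
`c4L/c4H` (`(√2/4)ⁿ`), `wbL/wbH` (`tildeCoef m n (β/2)^m`), `twH` (`· (√2/2)^{m+n}`), the initial
values (5.2) and the upward powers `powsH`. Every statement has the shape
"lower table entry ≤ true value · O" or "true value · O ≤ upper table entry". Theorems only.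
-/

noncomputable section

namespace Literature.Barriers.CriticalPhenomena.HierarchicalRG.Thm22Cert

open Finset

/-! ### Arithmetic soundness of the fixed-point primitives -/

/-- `x ≤ ⌈x/y⌉ · y`. [folklore] -/
theorem le_cdiv_mul (x : ℕ) {y : ℕ} (hy : 0 < y) : x ≤ cdiv x y * y := by
  unfold cdiv
  have h1 := Nat.div_add_mod' (x + y - 1) y
  have h2 := Nat.mod_lt (x + y - 1) hy
  generalize (x + y - 1) / y * y = t at h1
  omega

/-- Real form: `x / y ≤ cdiv x y`. [folklore] -/
theorem div_le_cdiv (x : ℕ) {y : ℕ} (hy : 0 < y) : (x : ℝ) / y ≤ (cdiv x y : ℕ) := by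
  rw [div_le_iff₀ (by exact_mod_cast hy)]
  exact_mod_cast le_cdiv_mul x hy

/-- `nsum f k = Σ_{i<k} f i`. [folklore] -/
theorem nsum_eq (f : ℕ → ℕ) (k : ℕ) : nsum f k = ∑ i ∈ range k, f i := by
  induction k with
  | zero => rfl
  | succ k ih => rw [nsum, ih, Finset.sum_range_succ]

/-- `binom = Nat.choose`. [folklore] -/
theorem binom_eq (n k : ℕ) : binom n k = n.choose k :=
  (Nat.choose_eq_descFactorial_div_factorial n k).symm

/-- Access to a tabulated function. [folklore] -/
theorem get_map_range (f : ℕ → ℕ) {K i : ℕ} (hi : i < K) : get ((List.range K).map f) i = f i := by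
  simp [get, List.getD_eq_getElem?_getD, List.getElem?_map, List.getElem?_range hi]

/-- Access to a tabulated nested function. [folklore] -/
theorem get2_map_range (f : ℕ → List ℕ) {K i : ℕ} (hi : i < K) (j : ℕ) :
    get2 ((List.range K).map f) i j = (f i).getD j 0 := by
  simp [get2, List.getD_eq_getElem?_getD, List.getElem?_map, List.getElem?_range hi]

/-- `get (x :: l) 0 = x`. [folklore] -/
@[simp] theorem get_cons_zero (x : ℕ) (l : List ℕ) : get (x :: l) 0 = x := rfl

/-- `get (x :: l) (i+1) = get l i`. [folklore] -/
@[simp] theorem get_cons_succ (x : ℕ) (l : List ℕ) (i : ℕ) : get (x :: l) (i + 1) = get l i := rfl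

/-- The weight identity `wnum n (m+1) = wnum n m · 2(2n+2m+1)`. [folklore] -/
theorem wnum_succ (n m : ℕ) : wnum n (m + 1) = wnum n m * (2 * (2 * n + 2 * m + 1)) := rfl

/-- The factorial identity behind `wnum`: `(2m+2n)! n! = wnum n m · (m+n)! (2n)!`. [folklore] -/
theorem wnum_mul (n m : ℕ) :
    (2 * m + 2 * n).factorial * n.factorial = wnum n m * (m + n).factorial * (2 * n).factorial := by
  induction m with
  | zero => simp [wnum]; ring
  | succ m ih =>
    rw [wnum_succ, show 2 * (m + 1) + 2 * n = (2 * m + 2 * n + 1) + 1 by ring, Nat.factorial_succ,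
      Nat.factorial_succ (2 * m + 2 * n), show m + 1 + n = (m + n) + 1 by ring,
      Nat.factorial_succ (m + n)]
    calc (2 * m + 2 * n + 1 + 1) * ((2 * m + 2 * n + 1) * (2 * m + 2 * n).factorial) * n.factorial
        = (2 * m + 2 * n + 1 + 1) * (2 * m + 2 * n + 1) * ((2 * m + 2 * n).factorial * n.factorial) := by
          ring
      _ = (2 * m + 2 * n + 1 + 1) * (2 * m + 2 * n + 1) *
            (wnum n m * (m + n).factorial * (2 * n).factorial) := by rw [ih]
      _ = wnum n m * (2 * (2 * n + 2 * m + 1)) * ((m + n + 1) * (m + n).factorial) *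
            (2 * n).factorial := by ring

/-- The weight of (5.6) in product form: `tildeCoef m n = wnum n m / m!`
(`(2m+2n)! n!/(m!(m+n)!(2n)!) = 2^m ∏_{i<m}(2n+2i+1) / m!`). [cite: HaraHattoriWatanabe2001, §5.1 eq. (5.6)] -/
theorem tildeCoef_eq_wnum_div (n m : ℕ) : tildeCoef m n = (wnum n m : ℝ) / m.factorial := by
  unfold tildeCoef
  have key : ((2 * m + 2 * n).factorial : ℝ) * n.factorial =
      (wnum n m : ℝ) * (m + n).factorial * (2 * n).factorial := by exact_mod_cast wnum_mul n m
  rw [key]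
  have h1 : ((m + n).factorial : ℝ) ≠ 0 := by positivity
  have h2 : ((2 * n).factorial : ℝ) ≠ 0 := by positivity
  have h3 : (m.factorial : ℝ) ≠ 0 := by positivity
  field_simp

/-- `tildeCoef m n ≥ 0`. [folklore] -/
theorem tildeCoef_nonneg (m n : ℕ) : 0 ≤ tildeCoef m n := by unfold tildeCoef; positivity

/-- `β(√2) = 1/√2 - 1/2 = √2/2 - 1/2`. [cite: HaraHattoriWatanabe2001, §1 eqs. (1.1), (1.4)] -/
theorem beta_sqrt_two_eq : beta (Real.sqrt 2) = Real.sqrt 2 / 2 - 1 / 2 := by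
  unfold beta
  rw [Real.sqrt_div_self']

namespace Cfg

variable (C : Cfg)

/-- `2^P > 0` as a real. [folklore] -/
theorem one_pos : (0 : ℝ) < C.one := by unfold one; positivity

/-- `2^P > 0` as a natural number. [folklore] -/
theorem one_pos_nat : 0 < C.one := by unfold one; positivity

/-- `one = 2^P` cast. [folklore] -/
theorem one_cast : ((C.one : ℕ) : ℝ) = (2 : ℝ) ^ C.P := by unfold one; push_cast; rfl

/-- Meaning of `sqrtOK`: `s2L/2^P ≤ √2 ≤ s2H/2^P`, and `2^P ≤ s2L`. [folklore] -/
theorem sqrtOK_sound (h : C.sqrtOK = true) :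
    (C.s2L : ℝ) ≤ Real.sqrt 2 * C.one ∧ Real.sqrt 2 * C.one ≤ (C.s2H : ℝ) ∧ C.one ≤ C.s2L := by
  unfold sqrtOK at h
  simp only [Bool.and_eq_true, decide_eq_true_eq] at h
  obtain ⟨h1, h2⟩ := h
  have hO := C.one_pos
  have h1r : (C.s2L : ℝ) * C.s2L ≤ 2 * C.one * C.one := by exact_mod_cast h1
  have h2r : (2 : ℝ) * C.one * C.one < C.s2H * C.s2H := by exact_mod_cast h2
  have hs : Real.sqrt 2 * C.one = Real.sqrt (2 * C.one * C.one) := by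
    rw [show (2 : ℝ) * C.one * C.one = (C.one) ^ 2 * 2 by ring, Real.sqrt_mul' _ (by norm_num),
      Real.sqrt_sq hO.le, mul_comm]
  refine ⟨?_, ?_, ?_⟩
  · rw [hs, Real.le_sqrt (by positivity) (by positivity), sq]
    exact h1r
  · rw [hs, Real.sqrt_le_left (by positivity), sq]
    exact h2r.le
  · -- (s2L+1)^2 > 2 one^2 ≥ one^2, so s2L + 1 > one
    by_contra hlt
    push Not at hlt
    have : C.s2L + 1 ≤ C.one := hlt
    have h3 : (C.s2L + 1) * (C.s2L + 1) ≤ C.one * C.one := Nat.mul_le_mul this this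
    have h4 : C.s2H = C.s2L + 1 := rfl
    rw [h4] at h2
    have h5 : 0 < C.one := by unfold one; positivity
    nlinarith

/-- `betL ≤ β 2^P`. [folklore] -/
theorem betL_sound (h : C.sqrtOK = true) : (C.betL : ℝ) ≤ beta (Real.sqrt 2) * C.one := by
  obtain ⟨h1, -, h3⟩ := C.sqrtOK_sound h
  unfold betL
  rw [beta_sqrt_two_eq]
  have hsub : ((C.s2L - C.one : ℕ) : ℝ) = C.s2L - C.one := by push_cast [Nat.cast_sub h3]; ring
  calc ((C.s2L - C.one) / 2 : ℕ) ≤ ((C.s2L - C.one : ℕ) : ℝ) / 2 := by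
        have := Nat.cast_div_le (α := ℝ) (m := C.s2L - C.one) (n := 2)
        push_cast at this ⊢; exact this
    _ = ((C.s2L : ℝ) - C.one) / 2 := by rw [hsub]
    _ ≤ (Real.sqrt 2 * C.one - C.one) / 2 := by gcongr
    _ = (Real.sqrt 2 / 2 - 1 / 2) * C.one := by ring

/-- `β 2^P ≤ betH`. [folklore] -/
theorem betH_sound (h : C.sqrtOK = true) : beta (Real.sqrt 2) * C.one ≤ (C.betH : ℝ) := by
  obtain ⟨-, h2, h3⟩ := C.sqrtOK_sound h
  unfold betH
  rw [beta_sqrt_two_eq]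
  have h3' : C.one ≤ C.s2H := le_trans h3 (Nat.le_succ _)
  have hsub : ((C.s2H - C.one : ℕ) : ℝ) = C.s2H - C.one := by push_cast [Nat.cast_sub h3']; ring
  calc (Real.sqrt 2 / 2 - 1 / 2) * C.one = (Real.sqrt 2 * C.one - C.one) / 2 := by ring
    _ ≤ ((C.s2H : ℝ) - C.one) / 2 := by gcongr
    _ = ((C.s2H - C.one : ℕ) : ℝ) / (2 : ℕ) := by rw [hsub]; norm_num
    _ ≤ (cdiv (C.s2H - C.one) 2 : ℕ) := div_le_cdiv _ (by norm_num)

/-- `βc 2^P ≤ rH` (`c = √2`). [folklore] -/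
theorem rH_sound (h : C.sqrtOK = true) : beta (Real.sqrt 2) * Real.sqrt 2 * C.one ≤ (C.rH : ℝ) := by
  obtain ⟨-, h2, -⟩ := C.sqrtOK_sound h
  have hb := C.betH_sound h
  have hO := C.one_pos
  unfold rH
  calc beta (Real.sqrt 2) * Real.sqrt 2 * C.one = (beta (Real.sqrt 2) * C.one) * (Real.sqrt 2 * C.one) / C.one := by
        field_simp
    _ ≤ (C.betH : ℝ) * C.s2H / C.one := by
        have : 0 ≤ beta (Real.sqrt 2) * C.one := by have := beta_sqrt_two_pos; positivity
        gcongr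
    _ = ((C.betH * C.s2H : ℕ) : ℝ) / (C.one : ℕ) := by push_cast; ring
    _ ≤ (cdiv (C.betH * C.s2H) C.one : ℕ) := div_le_cdiv _ (by unfold one; positivity)

/-- `mulH x y ≥ x y / 2^P`. [folklore] -/
theorem mulH_sound (x y : ℕ) : (x : ℝ) * y / C.one ≤ (C.mulH x y : ℕ) := by
  unfold mulH
  have := div_le_cdiv (x * y) (y := C.one) (by unfold one; positivity)
  push_cast at this
  exact this

/-- Monotone use of `mulH`: if `u·O ≤ x` and `v·O ≤ y` with `u, v ≥ 0` then `u v O ≤ mulH x y`.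
[folklore] -/
theorem mulH_ge {x y : ℕ} {u v : ℝ} (_hu : 0 ≤ u) (hv : 0 ≤ v) (hx : u * C.one ≤ x)
    (hy : v * C.one ≤ y) : u * v * C.one ≤ (C.mulH x y : ℕ) := by
  have hO := C.one_pos
  refine le_trans ?_ (C.mulH_sound x y)
  rw [le_div_iff₀ hO]
  calc u * v * C.one * C.one = (u * C.one) * (v * C.one) := by ring
    _ ≤ (x : ℝ) * y := by
      apply mul_le_mul hx hy (by positivity) (by positivity)

/-- `2^{(P+k) n} = (2^k · 2^P)^n` as reals. [folklore] -/
theorem two_pow_mul_eq (k n : ℕ) : (2 : ℝ) ^ ((C.P + k) * n) = (2 ^ k * C.one) ^ n := by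
  rw [pow_mul, C.one_cast, ← pow_add, add_comm]

/-- `c4L n ≤ (√2/4)ⁿ 2^P`. [folklore] -/
theorem c4L_sound (h : C.sqrtOK = true) (n : ℕ) : (C.c4L n : ℝ) ≤ (Real.sqrt 2 / 4) ^ n * C.one := by
  obtain ⟨h1, -, -⟩ := C.sqrtOK_sound h
  have hO := C.one_pos
  have hbase : (C.s2L : ℝ) / (4 * C.one) ≤ Real.sqrt 2 / 4 := by
    rw [div_le_div_iff₀ (by positivity) (by norm_num)]; linarith
  have hpow := pow_le_pow_left₀ (by positivity) hbase n
  unfold c4L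
  calc ((C.s2L ^ n * C.one / 2 ^ ((C.P + 2) * n) : ℕ) : ℝ)
      ≤ ((C.s2L ^ n * C.one : ℕ) : ℝ) / ((2 ^ ((C.P + 2) * n) : ℕ) : ℝ) := Nat.cast_div_le
    _ = ((C.s2L : ℝ) / (4 * C.one)) ^ n * C.one := by
        push_cast
        rw [C.two_pow_mul_eq 2 n, div_pow]
        norm_num
        ring
    _ ≤ (Real.sqrt 2 / 4) ^ n * C.one := mul_le_mul_of_nonneg_right hpow hO.le

/-- `(√2/4)ⁿ 2^P ≤ c4H n`. [folklore] -/
theorem c4H_sound (h : C.sqrtOK = true) (n : ℕ) : (Real.sqrt 2 / 4) ^ n * C.one ≤ (C.c4H n : ℝ) := by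
  obtain ⟨-, h2, -⟩ := C.sqrtOK_sound h
  have hO := C.one_pos
  have hbase : Real.sqrt 2 / 4 ≤ (C.s2H : ℝ) / (4 * C.one) := by
    rw [div_le_div_iff₀ (by norm_num) (by positivity)]; linarith
  have hpow := pow_le_pow_left₀ (by positivity) hbase n
  unfold c4H
  calc (Real.sqrt 2 / 4) ^ n * C.one ≤ ((C.s2H : ℝ) / (4 * C.one)) ^ n * C.one :=
        mul_le_mul_of_nonneg_right hpow hO.le
    _ = ((C.s2H ^ n * C.one : ℕ) : ℝ) / ((2 ^ ((C.P + 2) * n) : ℕ) : ℝ) := by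
        push_cast
        rw [C.two_pow_mul_eq 2 n, div_pow]
        norm_num
        ring
    _ ≤ (cdiv (C.s2H ^ n * C.one) (2 ^ ((C.P + 2) * n)) : ℕ) := div_le_cdiv _ (by positivity)

/-- `wbL n m ≤ w(n,m) (β/2)^m 2^P`. [folklore] -/
theorem wbL_sound (h : C.sqrtOK = true) (n m : ℕ) :
    (C.wbL n m : ℝ) ≤ tildeCoef m n * (beta (Real.sqrt 2) / 2) ^ m * C.one := by
  have hb := C.betL_sound h
  have hO := C.one_pos
  have hbase : (C.betL : ℝ) / (2 * C.one) ≤ beta (Real.sqrt 2) / 2 := by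
    rw [div_le_div_iff₀ (by positivity) (by norm_num)]; linarith
  have hpow := pow_le_pow_left₀ (by positivity) hbase m
  have hw : 0 ≤ (wnum n m : ℝ) / m.factorial := by positivity
  unfold wbL
  calc ((wnum n m * C.betL ^ m * C.one / (m.factorial * 2 ^ ((C.P + 1) * m)) : ℕ) : ℝ)
      ≤ ((wnum n m * C.betL ^ m * C.one : ℕ) : ℝ) / ((m.factorial * 2 ^ ((C.P + 1) * m) : ℕ) : ℝ) :=
        Nat.cast_div_le
    _ = (wnum n m : ℝ) / m.factorial * ((C.betL : ℝ) / (2 * C.one)) ^ m * C.one := by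
        push_cast
        rw [C.two_pow_mul_eq 1 m, div_pow]
        field_simp
    _ ≤ (wnum n m : ℝ) / m.factorial * (beta (Real.sqrt 2) / 2) ^ m * C.one := by
        apply mul_le_mul_of_nonneg_right _ hO.le
        exact mul_le_mul_of_nonneg_left hpow hw
    _ = tildeCoef m n * (beta (Real.sqrt 2) / 2) ^ m * C.one := by rw [tildeCoef_eq_wnum_div]

/-- `w(n,m) (β/2)^m 2^P ≤ wbH n m`. [folklore] -/
theorem wbH_sound (h : C.sqrtOK = true) (n m : ℕ) :
    tildeCoef m n * (beta (Real.sqrt 2) / 2) ^ m * C.one ≤ (C.wbH n m : ℝ) := by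
  have hb := C.betH_sound h
  have hO := C.one_pos
  have hβ := beta_sqrt_two_pos
  have hbase : beta (Real.sqrt 2) / 2 ≤ (C.betH : ℝ) / (2 * C.one) := by
    rw [div_le_div_iff₀ (by norm_num) (by positivity)]; linarith
  have hpow := pow_le_pow_left₀ (by positivity) hbase m
  have hw : 0 ≤ (wnum n m : ℝ) / m.factorial := by positivity
  unfold wbH
  calc tildeCoef m n * (beta (Real.sqrt 2) / 2) ^ m * C.one
      ≤ (wnum n m : ℝ) / m.factorial * ((C.betH : ℝ) / (2 * C.one)) ^ m * C.one := by
        rw [tildeCoef_eq_wnum_div]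
        apply mul_le_mul_of_nonneg_right _ hO.le
        exact mul_le_mul_of_nonneg_left hpow hw
    _ = ((wnum n m * C.betH ^ m * C.one : ℕ) : ℝ) / ((m.factorial * 2 ^ ((C.P + 1) * m) : ℕ) : ℝ) := by
        push_cast
        rw [C.two_pow_mul_eq 1 m, div_pow]
        field_simp
    _ ≤ (cdiv (wnum n m * C.betH ^ m * C.one) (m.factorial * 2 ^ ((C.P + 1) * m)) : ℕ) :=
        div_le_cdiv _ (by positivity)

/-- `w(n,m) (β/2)^m (√2/2)^{m+n} 2^P ≤ twH n m`. [folklore] -/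
theorem twH_sound (h : C.sqrtOK = true) (n m : ℕ) :
    tildeCoef m n * (beta (Real.sqrt 2) / 2) ^ m * (Real.sqrt 2 / 2) ^ (m + n) * C.one ≤ (C.twH n m : ℝ) := by
  obtain ⟨-, h2, -⟩ := C.sqrtOK_sound h
  have hb := C.betH_sound h
  have hO := C.one_pos
  have hβ := beta_sqrt_two_pos
  have hbase : beta (Real.sqrt 2) / 2 ≤ (C.betH : ℝ) / (2 * C.one) := by
    rw [div_le_div_iff₀ (by norm_num) (by positivity)]; linarith
  have hpow := pow_le_pow_left₀ (by positivity) hbase m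
  have hbase2 : Real.sqrt 2 / 2 ≤ (C.s2H : ℝ) / (2 * C.one) := by
    rw [div_le_div_iff₀ (by norm_num) (by positivity)]; linarith
  have hpow2 := pow_le_pow_left₀ (by positivity) hbase2 (m + n)
  have hw : 0 ≤ (wnum n m : ℝ) / m.factorial := by positivity
  unfold twH
  calc tildeCoef m n * (beta (Real.sqrt 2) / 2) ^ m * (Real.sqrt 2 / 2) ^ (m + n) * C.one
      ≤ (wnum n m : ℝ) / m.factorial * ((C.betH : ℝ) / (2 * C.one)) ^ m *
          ((C.s2H : ℝ) / (2 * C.one)) ^ (m + n) * C.one := by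
        rw [tildeCoef_eq_wnum_div]
        apply mul_le_mul_of_nonneg_right _ hO.le
        apply mul_le_mul (mul_le_mul_of_nonneg_left hpow hw) hpow2 (by positivity) (by positivity)
    _ = ((wnum n m * C.betH ^ m * C.s2H ^ (m + n) * C.one : ℕ) : ℝ) /
          ((m.factorial * 2 ^ ((C.P + 1) * m) * 2 ^ ((C.P + 1) * (m + n)) : ℕ) : ℝ) := by
        push_cast
        rw [C.two_pow_mul_eq 1 m, C.two_pow_mul_eq 1 (m + n), div_pow, div_pow]
        field_simp
    _ ≤ (cdiv (wnum n m * C.betH ^ m * C.s2H ^ (m + n) * C.one)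
          (m.factorial * 2 ^ ((C.P + 1) * m) * 2 ^ ((C.P + 1) * (m + n))) : ℕ) :=
        div_le_cdiv _ (by positivity)

/-- The initial values: `initLo ≤ a_{n,0} 2^P ≤ initHi` with `a_{n,0} = n! s^{2n}/(2n)!`,
`s = sNum / 10¹⁶`. [cite: HaraHattoriWatanabe2001, §5.1 eq. (5.2)] -/
theorem init_sound (sNum n : ℕ) :
    (C.initLo sNum n : ℝ) ≤ (n.factorial : ℝ) / (2 * n).factorial * ((sNum : ℝ) / 10 ^ 16) ^ (2 * n) * C.one ∧
    (n.factorial : ℝ) / (2 * n).factorial * ((sNum : ℝ) / 10 ^ 16) ^ (2 * n) * C.one ≤ (C.initHi sNum n : ℝ) := by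
  have hO := C.one_pos
  have hval : (n.factorial : ℝ) / (2 * n).factorial * ((sNum : ℝ) / 10 ^ 16) ^ (2 * n) * C.one =
      ((n.factorial * sNum ^ (2 * n) * C.one : ℕ) : ℝ) / (((2 * n).factorial * 10 ^ (32 * n) : ℕ) : ℝ) := by
    push_cast
    rw [div_pow, ← pow_mul, show 16 * (2 * n) = 32 * n by ring]
    field_simp
  unfold initLo initHi
  rw [hval]
  exact ⟨Nat.cast_div_le, div_le_cdiv _ (by positivity)⟩

/-- Entries of `powsH`: `get (powsH h k x) i` for `i ≤ k` dominates `x (h/O)^i`-type products: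
if `u O ≤ x` and `v O ≤ h` (`u, v ≥ 0`) then `u v^i O ≤ get (powsH h k x) i`. [folklore] -/
theorem powsH_sound {h : ℕ} {v : ℝ} (hv : 0 ≤ v) (hh : v * C.one ≤ h) :
    ∀ (k : ℕ) {x : ℕ} {u : ℝ}, 0 ≤ u → u * C.one ≤ x → ∀ i ≤ k,
      u * v ^ i * C.one ≤ (get (C.powsH h k x) i : ℝ) := by
  intro k
  induction k with
  | zero =>
    intro x u hu hx i hi
    have : i = 0 := by omega
    subst this
    simpa [powsH, get] using hx
  | succ k ih =>
    intro x u hu hx i hi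
    rcases i with _ | i
    · simpa [powsH, get] using hx
    · have hstep : u * v * C.one ≤ (C.mulH x h : ℝ) := C.mulH_ge hu hv hx hh
      have := ih (x := C.mulH x h) (u := u * v) (by positivity) hstep i (by omega)
      simp only [powsH, get_cons_succ]
      calc u * v ^ (i + 1) * C.one = u * v * v ^ i * C.one := by ring
        _ ≤ _ := this

end Cfg

end Literature.Barriers.CriticalPhenomena.HierarchicalRG.Thm22Cert

end
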